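import Summits.BirchSwinnertonDyer.BirchSwinnertonDyer.Theorems.PrintCFramBottomClassIndexLawFiveLeFlipRungTwoEightThetaFactor
import Summits.BirchSwinnertonDyer.BirchSwinnertonDyer.Theorems.PrintCFramBottomClassIndexLawFiveLeFlipRungTwoEightJunk
import Summits.BirchSwinnertonDyer.BirchSwinnertonDyer.Theorems.PrintCFramBottomClassIndexLawFiveLeFlipRungTwoThetaSeries
import HarnessLib

set_option autoImplicit false

/-!
# Crux `PrintCFram.BottomClassIndexLawFiveLe` (stmt-BirchSwinnertonDyer-20372), line `eisenstein-resource-bdp-line` (registry v29 `stub_flipRungs.2`,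
# the `8 ∣ m` half = LEAD's residual `stub_rungTwoEight` / w6 g10's (JMLTwoEight⁶)):
# THE 2-ADIC FLIPPED-CUSP RUNG FOR `e = 3`, piece P6e (second half) — THE Θ(16·)-SIDE HYPOTHESES OF THE NF-Q TRANSPORT, DISCHARGED
# (cell `bsd-print-cfram`, width seat `bsd-line-cfram-p1-w8` g10; THEOREMS ONLY, `--supports` 20372 `--as helper`; BSD is not proved by any of this)

HONEST FRAMING. Analysis of one explicit function on `ℍ`; nothing here is a statement about BSD; no registered stub is closed. This is the
`R = 16` twin of w5 g8's P4c (`…FlipRungTwoThetaSeries`). In P6e/1 (`…FlipRungTwoEightThetaFactor.slash_flippedCusp_eq_thetaSixteen_mul_bracket`)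
the product vehicle `V = P·θ(16·)` at `γ₀ = [a b; M 256] ∈ SL₂(ℤ)` (`M` odd) was factorised as `(V ∣_{k+1} γ₀)(z) = Θ(z)·B(z)` with

  `Θ(z) := θ(16·(γ₀•z)) · (√((Mz+256)/16))⁻¹ = (√(2iM))⁻¹ · Σ_{k∈ℤ} e(8k²/M)·G(16a,k;M) · e(k²z/64)`.

w3 g19's transport `exists_isIntegral_qExpansion_coeff_of_slash_eq_mul` needs three facts about `Θ` for a width `N` (`64 ∣ N`, `2M ∣ N`), proved here:
* §1 `Θ` is `64`-PERIODIC (P6d's `junkTranslateSixteen_periodic_of_ratio` at `g = θ(16·) ∈ M_{1/2}(64)` — the tree's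
  `thetaMul_sq_mem_halfIntModularForms` at `Q = 4` —, `j₁ = 0`), HOLOMORPHIC
  (`√((Mz+256)/16) = j(·; M, 256)(z)/4`) and BOUNDED AT `i∞` (`‖Θ‖² = 16·‖slashSq 1 θ(16·) γ₀‖`); hence (hΘ) analyticity of `cuspFunction N Θ` at `0`
  and Mathlib's `HasSum` of `qExpansion N Θ`;
* §2 THE EXPLICIT `𝕢_N`-SERIES (`N = 64N₁`): `Θ(z) = Σ_K T(K) 𝕢_N(z)^K`, `T = extend (n ↦ N₁n²) A 0`,
  `A(n) = (√(2iM))⁻¹·(2 − [n=0])·e(8n²/M)·G(16a,n;M)`;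
* §3 (hΘint) every `T(K) ∈ ℤ̄[1/N]` and (hΘ0) `T(0) = (√(2iM))⁻¹·G(16a;M)` is a UNIT of `ℤ̄[1/N]` (P6e/1 `thetaSixteen_constant_unit`); packaged as
  **`thetaSixteen_transport_hypotheses`**.

No definitions, no named facts, no `sorry`. beyond-print theorem: NO. References: [Shimura1973HalfIntegral] §1; [KoblitzECMF1993] III §3–§4, IV §1;
[DiamondShurman2005] §1.1; crux notes w7g8-T6 §5d (P4); w8 g10 STATUS 11:14:53Z.
-/

-- summit-side namespace `Summit.BirchSwinnertonDyer.BirchSwinnertonDyer.…` (single-conjunct summit, D-0017 layout)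
set_option linter.dupNamespace false

noncomputable section

open scoped MatrixGroups ModularForm Real Classical Topology Manifold NumberTheorySymbols
open UpperHalfPlane hiding I
open Complex CongruenceSubgroup Function Filter
open Literature.NumberTheory.EllipticCurves.ModularForms
open Literature.NumberTheory.EllipticCurves.Tunnell1983 (thetaMul thetaMul_eq_shimuraTheta)

namespace Summit.BirchSwinnertonDyer.BirchSwinnertonDyer.Theorems.PrintCFram.FlipRung

open Summit.BirchSwinnertonDyer.BirchSwinnertonDyer.Theorems.PrintCFram.HalfIntegralBridge

/-! ## §1 `Θ` is periodic, holomorphic and bounded at `i∞` -/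

/-- **`Θ` is `64`-periodic:** `θ(16·(γ₀•(z+64)))·(√((M(z+64)+256)/16))⁻¹ = θ(16·(γ₀•z))·(√((Mz+256)/16))⁻¹` (P6d's conjugation
`γ₀T⁶⁴γ₀⁻¹ ∈ Γ₀(64)` with trivial multiplier, at `g = θ(16·)`). [cite: Shimura1973HalfIntegral, §1] -/
theorem thetaSixteenCusp_periodic (γ₀ : SL(2, ℤ)) {M : ℕ} (hM : (γ₀ 1 0 : ℤ) = M) (h256 : (γ₀ 1 1 : ℤ) = 256) (hM0 : M ≠ 0) (z : ℍ) :
    thetaMul 16 (γ₀ • ((64 : ℝ) +ᵥ z)) * (Complex.sqrt (((M : ℂ) * ((((64 : ℝ) +ᵥ z : ℍ)) : ℂ) + 256) / 16))⁻¹ =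
      thetaMul 16 (γ₀ • z) * (Complex.sqrt (((M : ℂ) * z + 256) / 16))⁻¹ := by
  have hMpos : 0 < M := Nat.pos_of_ne_zero hM0
  have hX : 0 < (((M : ℂ) * z + 256) / 16).im := by
    rw [show ((M : ℂ) * z + 256) / 16 = ((M : ℂ) * z + 256) / ((16 : ℝ) : ℂ) by norm_num, Complex.div_ofReal_im]
    exact div_pos (im_level_mul_add_256_pos hMpos z) (by norm_num)
  have hY : 0 < (((M : ℂ) * ((z : ℂ) + 64) + 256) / 16).im := by
    rw [show ((M : ℂ) * ((z : ℂ) + 64) + 256) / 16 = ((M : ℂ) * ((z : ℂ) + 64) + 256) / ((16 : ℝ) : ℂ) by norm_num,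
      Complex.div_ofReal_im]
    have : ((M : ℂ) * ((z : ℂ) + 64) + 256).im = (M : ℝ) * z.im := by simp
    rw [this]; exact div_pos (mul_pos (by exact_mod_cast hMpos) z.im_pos) (by norm_num)
  -- `θ(16·) ∈ M_{1/2}(64, 1)`: the tree's `thetaMul_sq_mem_halfIntModularForms` at `Q = 4` (also `Tunnell1983.thetaMul_sixteen_mem_halfIntModularForms_64`)
  have hθ : thetaMul 16 ∈ halfIntModularForms 1 64 1 := by
    have h := thetaMul_sq_mem_halfIntModularForms (Q := 4) (by norm_num); norm_num at h; exact h
  have h := junkTranslateSixteen_periodic_of_ratio (κ := 1) (ψ := (1 : DirichletCharacter ℂ 64)) (by norm_num : 4 ∣ 64)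
    hθ γ₀ (M := (M : ℤ)) hM h256 (by exact_mod_cast hM0)
    ⟨(M : ℤ) ^ 2, by ring⟩ 0 ⟨(M : ℤ) * γ₀ 0 0, by ring⟩ z hX hY (by
      have hX0 : ((M : ℂ) * z + 256) ≠ 0 := by
        intro h0; have := im_level_mul_add_256_pos hMpos z; rw [h0] at this; simp at this
      push_cast
      field_simp)
  simp only [Int.cast_zero, zero_div, zero_vadd, pow_one] at h
  have h64 : ((((64 : ℝ) +ᵥ z : ℍ)) : ℂ) = (z : ℂ) + 64 := by rw [coe_vadd]; push_cast; ring
  rw [h64]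
  exact h

/-- `Θ` composed with `ofComplex` is `64`-periodic on `ℂ`. [folklore] -/
theorem thetaSixteenCusp_periodic_comp_ofComplex (γ₀ : SL(2, ℤ)) {M : ℕ} (hM : (γ₀ 1 0 : ℤ) = M) (h256 : (γ₀ 1 1 : ℤ) = 256)
    (hM0 : M ≠ 0) :
    Periodic ((fun z : ℍ ↦ thetaMul 16 (γ₀ • z) * (Complex.sqrt (((M : ℂ) * z + 256) / 16))⁻¹) ∘ ofComplex) (64 : ℝ) := by
  intro w
  by_cases hw : 0 < w.im
  · have h1w : 0 < (w + (64 : ℝ)).im := by simpa using hw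
    simp only [Function.comp_apply]
    rw [ofComplex_apply_of_im_pos h1w, ofComplex_apply_of_im_pos hw]
    have e : (⟨w + (64 : ℝ), h1w⟩ : ℍ) = (64 : ℝ) +ᵥ ⟨w, hw⟩ := by
      ext; simp [coe_vadd, add_comm]
    rw [e]
    exact thetaSixteenCusp_periodic γ₀ hM h256 hM0 ⟨w, hw⟩
  · simp only [Function.comp_apply]
    rw [ofComplex_apply_eq_of_im_nonpos (by simpa using not_lt.mp hw) (not_lt.mp hw)]

/-- `Θ` composed with `ofComplex` is `N`-periodic for `64 ∣ N`. [folklore] -/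
theorem thetaSixteenCusp_periodic_comp_ofComplex_of_dvd (γ₀ : SL(2, ℤ)) {M : ℕ} (hM : (γ₀ 1 0 : ℤ) = M) (h256 : (γ₀ 1 1 : ℤ) = 256)
    (hM0 : M ≠ 0) {N : ℕ} (hN : 64 ∣ N) :
    Periodic ((fun z : ℍ ↦ thetaMul 16 (γ₀ • z) * (Complex.sqrt (((M : ℂ) * z + 256) / 16))⁻¹) ∘ ofComplex) (N : ℝ) := by
  obtain ⟨n, rfl⟩ := hN
  have h := (thetaSixteenCusp_periodic_comp_ofComplex γ₀ hM h256 hM0).nat_mul n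
  push_cast
  rw [mul_comm] at h
  exact h

/-- `√(X/16) = √X/√16` for `X ∈ ℍ` (principal branch). [folklore] -/
theorem csqrt_div_sixteen_eq {X : ℂ} (hX : 0 < X.im) :
    Complex.sqrt (X / 16) = Complex.sqrt X * ((Real.sqrt 16 : ℝ) : ℂ)⁻¹ := by
  have h16 : ((Real.sqrt 16 : ℝ) : ℂ) ^ 2 = 16 := by
    rw [← Complex.ofReal_pow, Real.sq_sqrt (by norm_num)]; norm_num
  have h16ne : ((Real.sqrt 16 : ℝ) : ℂ) ≠ 0 := by
    intro h; rw [h] at h16; norm_num at h16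
  have hq := csqrt_mem_quadrant hX
  refine csqrt_eq_of_sq_eq' ?_ (Or.inl ?_)
  · rw [mul_pow, inv_pow, csqrt_sq, h16]; ring
  · rw [← Complex.ofReal_inv]
    simp only [Complex.mul_re, Complex.ofReal_re, Complex.ofReal_im, mul_zero, sub_zero]
    exact mul_pos hq.1 (inv_pos.mpr (Real.sqrt_pos.mpr (by norm_num)))

/-- `√((Mz+256)/16) = j(·; M, 256)(z)/√16` for odd `M`: the base of P6c is Shimura's `thetaFactor M 256` (`ε_256 = 1`, `(M/256) = (M/2)⁸ = 1`) over
`√16`. [cite: Shimura1973HalfIntegral, §1] -/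
theorem csqrt_level_div_sixteen_eq_thetaFactor {M : ℕ} (hM : Odd M) (z : ℍ) :
    Complex.sqrt (((M : ℂ) * z + 256) / 16) = thetaFactor M 256 z * ((Real.sqrt 16 : ℝ) : ℂ)⁻¹ := by
  have hMpos : 0 < M := hM.pos
  rw [csqrt_div_sixteen_eq (im_level_mul_add_256_pos hMpos z)]
  congr 1
  unfold thetaFactor
  have hε : thetaEps 256 = 1 := by unfold thetaEps; norm_num
  have hσ : shimuraSymbol M 256 = 1 := by
    have hcop : Nat.Coprime M 2 :=
      ((Nat.Prime.coprime_iff_not_dvd Nat.prime_two).mpr (by obtain ⟨m, hm⟩ := hM; omega)).symm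
    have hg : ((M : ℤ)).gcd 2 = 1 := by rw [Int.gcd_eq_natAbs]; simpa using hcop.gcd_eq_one
    have hJ : J((M : ℤ) | 256) = 1 := by
      rw [show (256 : ℕ) = 2 ^ (2 * 4) by norm_num, jacobiSym.pow_right, pow_mul, jacobiSym.sq_one hg, one_pow]
    unfold shimuraSymbol
    norm_num [hJ]
  rw [hε, hσ]
  push_cast
  ring

/-- **`Θ` is holomorphic on `ℍ`.** [folklore] -/
theorem mdifferentiable_thetaSixteenCusp (γ₀ : SL(2, ℤ)) {M : ℕ} (hModd : Odd M) :
    MDifferentiable 𝓘(ℂ) 𝓘(ℂ) (fun z : ℍ ↦ thetaMul 16 (γ₀ • z) * (Complex.sqrt (((M : ℂ) * z + 256) / 16))⁻¹) := by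
  have hθ : thetaMul 16 ∈ halfIntModularForms 1 64 1 := by
    have h := thetaMul_sq_mem_halfIntModularForms (Q := 4) (by norm_num); norm_num at h; exact h
  have h1 := mdifferentiable_comp_smul hθ.1 γ₀
  have hgcd : Int.gcd M 256 = 1 := by
    obtain ⟨m, hm⟩ := hModd
    have hc : IsCoprime (M : ℤ) (2 ^ 8) := IsCoprime.pow_right ⟨1, -(m : ℤ), by rw [hm]; push_cast; ring⟩
    have := Int.isCoprime_iff_gcd_eq_one.mp hc
    norm_num at this
    exact this
  have h2 : MDifferentiable 𝓘(ℂ) 𝓘(ℂ) (fun z : ℍ ↦ (Complex.sqrt (((M : ℂ) * z + 256) / 16))⁻¹) := by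
    have e : (fun z : ℍ ↦ (Complex.sqrt (((M : ℂ) * z + 256) / 16))⁻¹) =
        fun z : ℍ ↦ (thetaFactor M 256 z)⁻¹ * ((Real.sqrt 16 : ℝ) : ℂ) := by
      funext z; rw [csqrt_level_div_sixteen_eq_thetaFactor hModd, mul_inv, inv_inv]
    rw [e]
    refine MDifferentiable.mul ?_ mdifferentiable_const
    have hθ := mdifferentiable_thetaFactor (M : ℤ) 256
    rw [UpperHalfPlane.mdifferentiable_iff] at hθ ⊢
    refine (hθ.inv fun w hw ↦ ?_).congr fun w hw ↦ by simp [Function.comp_apply]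
    simp only [Function.comp_apply]
    exact thetaFactor_ne_zero hgcd _
  exact h1.mul h2

/-- **`Θ` is bounded at `i∞`:** `‖Θ(z)‖² = 16·‖slashSq 1 θ(16·) γ₀ z‖`, and `θ(16·) ∈ M_{1/2}(64)` satisfies the cusp condition at `γ₀`. [folklore] -/
theorem isBoundedAtImInfty_thetaSixteenCusp (γ₀ : SL(2, ℤ)) {M : ℕ} (hM : (γ₀ 1 0 : ℤ) = M) (h256 : (γ₀ 1 1 : ℤ) = 256)
    (hM0 : M ≠ 0) :
    IsBoundedAtImInfty (fun z : ℍ ↦ thetaMul 16 (γ₀ • z) * (Complex.sqrt (((M : ℂ) * z + 256) / 16))⁻¹) := by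
  have hθ : thetaMul 16 ∈ halfIntModularForms 1 64 1 := by
    have h := thetaMul_sq_mem_halfIntModularForms (Q := 4) (by norm_num); norm_num at h; exact h
  have h := hθ.2.2 γ₀
  rw [isBoundedAtImInfty_iff] at h ⊢
  obtain ⟨B, A, hB⟩ := h
  refine ⟨Real.sqrt (16 * B), A, fun z hz ↦ ?_⟩
  have hMpos : 0 < M := Nat.pos_of_ne_zero hM0
  have hden : denom γ₀ z = (M : ℂ) * z + 256 := by rw [ModularGroup.denom_apply, hM, h256]; push_cast; ring
  have hX0 : (M : ℂ) * z + 256 ≠ 0 := by rw [← hden]; exact denom_ne_zero γ₀ z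
  have hslash : ‖slashSq 1 (thetaMul 16) γ₀ z‖ = ‖thetaMul 16 (γ₀ • z)‖ ^ 2 / ‖(M : ℂ) * z + 256‖ := by
    rw [norm_slashSq, pow_one, hden]
  have hn : ‖Complex.sqrt (((M : ℂ) * z + 256) / 16)‖ ^ 2 = ‖(M : ℂ) * z + 256‖ / 16 := by
    rw [← norm_pow, csqrt_sq, norm_div]
    norm_num
  have hX8 : ‖(M : ℂ) * z + 256‖ ≠ 0 := norm_ne_zero_iff.mpr hX0
  have hsq : ‖thetaMul 16 (γ₀ • z) * (Complex.sqrt (((M : ℂ) * z + 256) / 16))⁻¹‖ ^ 2 =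
      16 * ‖slashSq 1 (thetaMul 16) γ₀ z‖ := by
    rw [norm_mul, mul_pow, norm_inv, inv_pow, hn, hslash]
    field_simp
  have hle : ‖thetaMul 16 (γ₀ • z) * (Complex.sqrt (((M : ℂ) * z + 256) / 16))⁻¹‖ ^ 2 ≤ 16 * B := by
    rw [hsq]; exact mul_le_mul_of_nonneg_left (hB z hz) (by norm_num)
  calc ‖thetaMul 16 (γ₀ • z) * (Complex.sqrt (((M : ℂ) * z + 256) / 16))⁻¹‖
      = Real.sqrt (‖thetaMul 16 (γ₀ • z) * (Complex.sqrt (((M : ℂ) * z + 256) / 16))⁻¹‖ ^ 2) :=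
        (Real.sqrt_sq (norm_nonneg _)).symm
    _ ≤ Real.sqrt (16 * B) := Real.sqrt_le_sqrt hle

/-- **(hΘ) `AnalyticAt ℂ (cuspFunction N Θ) 0`** for `64 ∣ N`, `N ≥ 1`, and Mathlib's `HasSum` of `qExpansion N Θ`. [cite: DiamondShurman2005, §1.1] -/
theorem thetaSixteenCusp_analytic_and_hasSum (γ₀ : SL(2, ℤ)) {M : ℕ} (hM : (γ₀ 1 0 : ℤ) = M) (h256 : (γ₀ 1 1 : ℤ) = 256)
    (hModd : Odd M) {N : ℕ} (hN : 64 ∣ N) (hN0 : 0 < N) :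
    AnalyticAt ℂ (cuspFunction N (fun z : ℍ ↦ thetaMul 16 (γ₀ • z) * (Complex.sqrt (((M : ℂ) * z + 256) / 16))⁻¹)) 0 ∧
    ∀ τ : ℍ, HasSum (fun m : ℕ ↦ (qExpansion N (fun z : ℍ ↦ thetaMul 16 (γ₀ • z) * (Complex.sqrt (((M : ℂ) * z + 256) / 16))⁻¹)).coeff m •
        Periodic.qParam N (τ : ℂ) ^ m) (thetaMul 16 (γ₀ • τ) * (Complex.sqrt (((M : ℂ) * τ + 256) / 16))⁻¹) := by
  have hM0 : M ≠ 0 := hModd.pos.ne'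
  have hper := thetaSixteenCusp_periodic_comp_ofComplex_of_dvd γ₀ hM h256 hM0 hN
  have hhol := mdifferentiable_thetaSixteenCusp γ₀ hModd
  have hbdd := isBoundedAtImInfty_thetaSixteenCusp γ₀ hM h256 hM0
  have hNR : (0 : ℝ) < N := by exact_mod_cast hN0
  exact ⟨UpperHalfPlane.analyticAt_cuspFunction_zero hNR hper hhol hbdd,
    fun τ ↦ UpperHalfPlane.hasSum_qExpansion hNR hper hhol hbdd τ⟩

/-! ## §2 The explicit series of `Θ` in `𝕢_N` -/

/-- The term of `thetaMul_sixteen_flippedCusp_mul_inv_csqrt` as a `𝕢_N`-power (`N = 64N₁`): `exp(πi k² (X/16)/(2M)) = e(8k²/M)·𝕢_N(z)^{N₁ k²}`.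
[folklore] -/
theorem cexp_thetaSixteenTerm_eq_qParam_pow {M : ℕ} (hM : 0 < M) {N N₁ : ℕ} (hN : N = 64 * N₁) (hN₁ : 0 < N₁) (k : ℤ) (z : ℍ) :
    cexp (Real.pi * I * k ^ 2 * ((((M : ℂ) * z + 256) / 16) / (2 * M))) =
      cexp (8 * Real.pi * I * k ^ 2 / M) * Periodic.qParam (N : ℝ) (z : ℂ) ^ (N₁ * k.natAbs ^ 2) := by
  rw [cexp_thetaSixteenTerm_split hM, cexp_pi_I_sq_mul_div_thirtytwo_eq_qParam_pow, mul_comm]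
  congr 1
  rw [pow_mul]
  congr 1
  rw [Periodic.qParam, Periodic.qParam, ← Complex.exp_nat_mul, hN]
  congr 1
  have hN₁' : (N₁ : ℂ) ≠ 0 := by exact_mod_cast hN₁.ne'
  push_cast
  field_simp

/-- **THE EXPLICIT `𝕢_N`-SERIES OF `Θ`.** For `γ₀ = [a b; M 256]` (`M` odd), `N = 64N₁`, `N₁ ≥ 1`, and every `z ∈ ℍ`:
`Θ(z) = Σ_K T(K)·𝕢_N(z)^K` with `T = extend (n ↦ N₁n²) A 0`, `A(n) = (√(2iM))⁻¹ · (if n = 0 then 1 else 2) · e(8n²/M) · G(16a,n;M)`.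
[cite: Shimura1973HalfIntegral, §1] -/
theorem hasSum_thetaSixteenCusp (γ₀ : SL(2, ℤ)) {M : ℕ} [NeZero M] {a b : ℤ} (h00 : (γ₀ 0 0 : ℤ) = a) (h01 : (γ₀ 0 1 : ℤ) = b)
    (hM : (γ₀ 1 0 : ℤ) = M) (h256 : (γ₀ 1 1 : ℤ) = 256) {N N₁ : ℕ} (hN : N = 64 * N₁) (hN₁ : 0 < N₁) (z : ℍ) :
    HasSum (fun K : ℕ ↦ Function.extend (fun n : ℕ ↦ N₁ * n ^ 2)
        (fun n : ℕ ↦ (Complex.sqrt (2 * I * M))⁻¹ * ((if n = 0 then 1 else 2) *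
          (cexp (8 * Real.pi * I * (n : ℂ) ^ 2 / M) * quadGaussSum M ((16 * a : ℤ) : ZMod M) n))) 0 K *
        Periodic.qParam (N : ℝ) (z : ℂ) ^ K)
      (thetaMul 16 (γ₀ • z) * (Complex.sqrt (((M : ℂ) * z + 256) / 16))⁻¹) := by
  have hMpos : 0 < M := Nat.pos_of_ne_zero (NeZero.ne M)
  have hX : 0 < ((((M : ℂ) * z + 256) / 16)).im := by
    rw [show ((M : ℂ) * z + 256) / 16 = ((M : ℂ) * z + 256) / ((16 : ℝ) : ℂ) by norm_num, Complex.div_ofReal_im]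
    exact div_pos (im_level_mul_add_256_pos hMpos z) (by norm_num)
  -- the `ℤ`-indexed series
  have hsum := (summable_thetaTransform (c := M) (((16 * a : ℤ)) : ZMod M) (w := ((M : ℂ) * z + 256) / 16) hX).hasSum
  set f : ℤ → ℂ := fun k ↦ (Complex.sqrt (2 * I * M))⁻¹ *
    (cexp (8 * Real.pi * I * (k : ℂ) ^ 2 / M) * quadGaussSum M ((16 * a : ℤ) : ZMod M) k *
      Periodic.qParam (N : ℝ) (z : ℂ) ^ (N₁ * k.natAbs ^ 2))
    with hfdef
  have hf : HasSum f (thetaMul 16 (γ₀ • z) * (Complex.sqrt (((M : ℂ) * z + 256) / 16))⁻¹) := by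
    rw [thetaMul_sixteen_flippedCusp_mul_inv_csqrt γ₀ h00 h01 hM h256 z]
    refine (hsum.mul_left _).congr_fun fun k ↦ ?_
    simp only [hfdef]
    rw [cexp_thetaSixteenTerm_eq_qParam_pow hMpos hN hN₁ k z]
    ring
  have heven : ∀ n : ℕ, f (-(n : ℤ)) = f n := by
    intro n
    simp only [hfdef]
    push_cast
    rw [quadGaussSum_neg_right]
    simp [Int.natAbs_neg]
  have h2 := hasSum_nat_of_hasSum_int_even hf heven
  have hι : Injective (fun n : ℕ ↦ N₁ * n ^ 2) := by
    intro x y hxy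
    have := Nat.eq_of_mul_eq_mul_left hN₁ hxy
    exact Nat.pow_left_injective (by norm_num) this
  refine hasSum_extend_qParam hι (h2.congr_fun fun n ↦ ?_)
  simp only [hfdef]
  push_cast
  simp only [Int.natAbs_natCast]
  split_ifs with h0
  · subst h0; simp
  · ring

/-! ## §3 The three Θ-hypotheses of the transport -/

/-- The coefficient function of §2 takes values in `ℤ̄[1/N]` for `2M ∣ N` (`N₁ ≥ 1`). [folklore] -/
theorem thetaSixteenCoeff_mem {M N N₁ : ℕ} [NeZero M] (h2MN : 2 * M ∣ N) (hN₁ : 0 < N₁) (a : ℤ) (K : ℕ) :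
    ∃ j : ℕ, IsIntegral ℤ ((N : ℂ) ^ j *
      Function.extend (fun n : ℕ ↦ N₁ * n ^ 2)
        (fun n : ℕ ↦ (Complex.sqrt (2 * I * M))⁻¹ * ((if n = 0 then 1 else 2) *
          (cexp (8 * Real.pi * I * (n : ℂ) ^ 2 / M) * quadGaussSum M ((16 * a : ℤ) : ZMod M) n))) 0 K) := by
  have hι : Injective (fun n : ℕ ↦ N₁ * n ^ 2) := by
    intro x y hxy
    exact Nat.pow_left_injective (by norm_num) (Nat.eq_of_mul_eq_mul_left hN₁ hxy)
  by_cases hK : ∃ n, N₁ * n ^ 2 = K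
  · obtain ⟨n, rfl⟩ := hK
    rw [hι.extend_apply]
    refine exists_isIntegral_pow_mul_mul (csqrt_twoIM_inv_mem h2MN (NeZero.ne M)).1
      (exists_isIntegral_pow_mul_mul ?_ (exists_isIntegral_pow_mul_mul ?_
        (exists_isIntegral_pow_mul_of_isIntegral (isIntegral_quadGaussSum _ _))))
    · by_cases h0 : n = 0
      · rw [if_pos h0]; exact ⟨0, by simpa using isIntegral_one⟩
      · rw [if_neg h0]; exact exists_isIntegral_pow_mul_natCast 2
    · -- `e(4n²/M)` is a root of unity
      refine exists_isIntegral_pow_mul_of_isIntegral ?_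
      have he : cexp (8 * Real.pi * I * (n : ℂ) ^ 2 / M) = (ZMod.stdAddChar (((4 * n ^ 2 : ℕ) : ℤ) : ZMod M) : ℂ) := by
        rw [ZMod.stdAddChar_coe]; congr 1; push_cast; ring
      rw [he]; exact isIntegral_stdAddChar _
  · rw [Function.extend_apply' _ _ _ hK]
    exact ⟨0, by simpa using isIntegral_zero⟩

/-- **P6e — THE Θ(16·)-SIDE HYPOTHESES OF THE NF-Q TRANSPORT, DISCHARGED.** `γ₀ = [a b; M 256] ∈ SL₂(ℤ)`, `M` odd, `64 ∣ N`, `2M ∣ N`; with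
`Θ(z) = θ(16·(γ₀•z))·(√((Mz+256)/16))⁻¹` (the θ(16·)-factor of P6e/1's `slash_flippedCusp_eq_thetaSixteen_mul_bracket`):
(hΘ) `cuspFunction N Θ` is analytic at `0`; (hΘint) every coefficient of `qExpansion N Θ` lies in `ℤ̄[1/N]`; (hΘ0) its constant coefficient,
`(√(2iM))⁻¹·G(16a;M)`, is a unit of `ℤ̄[1/N]` — the three `Θ`-inputs of w3 g19's `exists_isIntegral_qExpansion_coeff_of_slash_eq_mul` for the
modulus-`16` flipped cusp. [cite: Shimura1973HalfIntegral, §1] [cite: Katz1973, §1.6 Cor. 1.6.2 (the consumer)] -/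
theorem thetaSixteen_transport_hypotheses (γ₀ : SL(2, ℤ)) {M : ℕ} [NeZero M] {a b : ℤ} (h00 : (γ₀ 0 0 : ℤ) = a)
    (h01 : (γ₀ 0 1 : ℤ) = b) (hM : (γ₀ 1 0 : ℤ) = M) (h256 : (γ₀ 1 1 : ℤ) = 256)
    (hModd : Odd M) {N : ℕ} (hN : 64 ∣ N) (hN0 : 0 < N) (h2MN : 2 * M ∣ N) :
    AnalyticAt ℂ (cuspFunction N (fun z : ℍ ↦ thetaMul 16 (γ₀ • z) * (Complex.sqrt (((M : ℂ) * z + 256) / 16))⁻¹)) 0 ∧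
    (∀ K : ℕ, ∃ j : ℕ, IsIntegral ℤ ((N : ℂ) ^ j *
      (qExpansion N (fun z : ℍ ↦ thetaMul 16 (γ₀ • z) * (Complex.sqrt (((M : ℂ) * z + 256) / 16))⁻¹)).coeff K)) ∧
    ∃ v : ℂ, (∃ j : ℕ, IsIntegral ℤ ((N : ℂ) ^ j * v)) ∧
      (qExpansion N (fun z : ℍ ↦ thetaMul 16 (γ₀ • z) * (Complex.sqrt (((M : ℂ) * z + 256) / 16))⁻¹)).coeff 0 * v = 1 := by
  obtain ⟨N₆, rfl⟩ := hN
  have hN₁ : 0 < N₆ := by omega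
  obtain ⟨han, -⟩ := thetaSixteenCusp_analytic_and_hasSum γ₀ hM h256 hModd ⟨N₆, rfl⟩ hN0
  have hNR : (0 : ℝ) < ((64 * N₆ : ℕ) : ℝ) := by exact_mod_cast hN0
  -- identify the coefficients with the explicit `T`
  have hT := fun K ↦ CuspGlue.qExpansion_coeff_unique_of_hasSum (c := fun K : ℕ ↦ Function.extend (fun n : ℕ ↦ N₆ * n ^ 2)
      (fun n : ℕ ↦ (Complex.sqrt (2 * I * M))⁻¹ * ((if n = 0 then 1 else 2) *
        (cexp (8 * Real.pi * I * (n : ℂ) ^ 2 / M) * quadGaussSum M ((16 * a : ℤ) : ZMod M) n))) 0 K) hNR han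
      (fun τ ↦ by
        simpa only [smul_eq_mul] using hasSum_thetaSixteenCusp γ₀ h00 h01 hM h256 (N := 64 * N₆) (N₁ := N₆) rfl hN₁ τ) K
  refine ⟨han, fun K ↦ ?_, ?_⟩
  · rw [← hT K]
    exact thetaSixteenCoeff_mem (M := M) (N₁ := N₆) h2MN hN₁ a K
  · -- the constant term: `extend ι A 0 0 = A 0 = (√(2iM))⁻¹ · G(16a;M)`
    have hι : Injective (fun n : ℕ ↦ N₆ * n ^ 2) := by
      intro x y hxy
      exact Nat.pow_left_injective (by norm_num) (Nat.eq_of_mul_eq_mul_left hN₁ hxy)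
    have h0 : (qExpansion (64 * N₆ : ℕ) (fun z : ℍ ↦ thetaMul 16 (γ₀ • z) * (Complex.sqrt (((M : ℂ) * z + 256) / 16))⁻¹)).coeff 0 =
        (Complex.sqrt (2 * I * M))⁻¹ * quadGaussSum M ((16 * a : ℤ) : ZMod M) 0 := by
      rw [← hT 0, extend_apply_zero_of_map_zero hι (by simp)]
      simp
    rw [h0]
    have hdet : 256 * a - (M : ℤ) * b = 1 := by
      have := Matrix.det_fin_two (γ₀ : Matrix (Fin 2) (Fin 2) ℤ)
      rw [Matrix.SpecialLinearGroup.det_coe, h00, h01, hM, h256] at this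
      linear_combination -this
    exact thetaSixteen_constant_unit (N := 64 * N₆) hModd h2MN hdet

end Summit.BirchSwinnertonDyer.BirchSwinnertonDyer.Theorems.PrintCFram.FlipRung

end
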